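import Summits.QuantumFields.YangMills.Theorems.AllWindowsColdBoxBoxHighLineGaussianSmallFieldTail
import Summits.QuantumFields.YangMills.Theorems.AllWindowsColdBoxBoxHighLineEdgeChartMoments
import Summits.QuantumFields.YangMills.Theorems.AllWindowsColdBoxBoxHighLineTiltSecondOrder

/-!
# T-S5.13r `RestrictionCov` — restricting a finite measure to a set of relative co-mass `τ` moves normalised averages of bounded observables
# by `≤ 2τB` and normalised covariances by `≤ 6τB²`; the Gaussian / small-field instance (ASSEMBLY-S5 Step C and (e3); LINE-19 S5 ⟨stmt-QuantumFields-24004⟩)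

Planner ym-idea-2 g18's brick **T-S5.13r** (2026-08-29T20:15:08Z (3), routed to the free-hands seat ym-line-fcl-p3 g26): the abstract Step-C conversion
lemma of `Cruxes/BoxHighWindowsSU22/ASSEMBLY-S5.md` §4/§6(e3), plus its instance in the `gaussAvg` letters of ✓`…Step2Wick`.

* §1 (abstract, ns `…AllWindowsColdBoxBoxHighLine.Restrict`).  `μ` finite and `≠ 0`, `D` measurable with `μ.real Dᶜ ≤ τ·μ.real univ`, `τ ≤ 1/2`;
  for `|h| ≤ B`: ★`abs_avg_sub_avg_restrict_le` `|∫h dμ/μ(univ) − ∫_D h dμ/μ(D)| ≤ 2τB`; for `|F|,|G| ≤ B`: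
  ★`abs_cov_sub_cov_restrict_le` `|Cov_μ(F,G) − Cov_{μ|D}(F,G)| ≤ 6τB²` (`Cov_ν(F,G) := ∫FG/ν(univ) − (∫F/ν(univ))(∫G/ν(univ))`).
* §2 (tilt letters of ✓`…Step2Tilt` at `t = 0`).  `Tilt.tiltExp μ U 0 G = ∫G dμ/μ.real univ`, `(μ.restrict D)`-version `= ∫_D G/μ.real D`;
  ★`abs_tiltCov_zero_sub_restrict_le` `|tiltCov μ U 0 F G − tiltCov (μ.restrict D) U 0 F G| ≤ 6τB²` (any `U`).
* §3 (Gaussian instance, ns `…AllWindowsColdBoxBoxHighLine.GaussRestrict`).  With `μ_G := volume.withDensity (ofReal ∘ gaussWeight β H)` (written out in full —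
  no definition): `IsFiniteMeasure μ_G`, `NeZero μ_G`, `∫ F dμ_G = ∫ F·gaussWeight`, `μ_G.real s = ∫_s gaussWeight`, ★`gaussAvg_eq_tiltExp_zero`
  (`gaussAvg β H F = tiltExp μ_G U 0 F`), `gaussCov_eq_tiltCov_zero`, `real_compl_smallField_eq` (`μ_G.real (smallField H s)ᶜ = E₀[1 − 1_{smallField s}]·μ_G.real univ`,
  ✓`GaussTail.gaussAvg_one_sub_sfInd_eq`), `restrict_smallField_eq` (`μ_G.restrict D = (volume.restrict D).withDensity (ofReal ∘ gaussWeight)` — the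
  assembler's `μ_D`), `volume_smallField_pos` / `neZero_restrict_smallField` (`s > 0`), and the instance
  ★★`abs_gaussCov_sub_tiltCov_restrict_le`: `E₀[1 − 1_{smallField s}] ≤ τ ≤ 1/2`, `|F|,|G| ≤ B` measurable ⇒
  `|gaussCov β H F G − tiltCov (μ_G.restrict (smallField H s)) U 0 F G| ≤ 6τB²` (τ from ✓6g `gaussianSmallFieldTail`).

Mathlib + tree (✓GaussianSmallFieldTail, ✓EdgeChartMoments, ✓TiltSecondOrder); no definitions.  HONEST LABEL: plumbing for the T-S5.13 assembly of the XL stub S5 of a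
critic-PASSed DRAFT line; S5, U5, ⟨24004⟩ ⟨24335⟩ ⟨24336⟩ remain OPEN; route AllWindowsColdBox is DRAFT; no rung is proved; **the Yang–Mills mass gap is NOT proved by
this file; no summit is proved by a line.**  Seat ym-line-fcl-p3 g26 (cell ym-idea-1).
-/

set_option autoImplicit false

noncomputable section

open MeasureTheory Set

namespace Summit.QuantumFields.YangMills.Theorems.AllWindowsColdBoxBoxHighLine

/-! ## §1 Abstract restriction lemmas -/

namespace Restrict

variable {Ω : Type*} [MeasurableSpace Ω] {μ : Measure Ω}

/-- Under `μ.real Dᶜ ≤ τ·μ.real univ` with `τ ≤ 1/2`, the set `D` carries at least half of the (positive, finite) mass. -/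
theorem half_le_real [IsFiniteMeasure μ] [NeZero μ] {D : Set Ω} (hD : MeasurableSet D) {τ : ℝ}
    (hτ : μ.real Dᶜ ≤ τ * μ.real univ) (hτ2 : τ ≤ 1 / 2) : μ.real univ / 2 ≤ μ.real D := by
  have hsplit := measureReal_add_measureReal_compl (μ := μ) hD
  have hm0 := measureReal_univ_pos (μ := μ)
  nlinarith

/-- A bounded a.e.-strongly-measurable function on a finite measure space is integrable. -/
theorem integrable_of_bounded [IsFiniteMeasure μ] {h : Ω → ℝ} {B : ℝ} (hm : AEStronglyMeasurable h μ) (hb : ∀ x, |h x| ≤ B) :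
    Integrable h μ :=
  (integrable_const B).mono' hm (Filter.Eventually.of_forall fun x => by rw [Real.norm_eq_abs]; exact hb x)

/-- ★ **Averages move by `≤ 2τB` under restriction.**  `μ` finite, `μ ≠ 0`, `μ.real Dᶜ ≤ τ·μ.real univ`, `τ ≤ 1/2`, `|h| ≤ B` a.e.-strongly measurable:
`|∫ h dμ / μ.real univ − ∫_D h dμ / μ.real D| ≤ 2τB`. -/
theorem abs_avg_sub_avg_restrict_le [IsFiniteMeasure μ] [NeZero μ] {D : Set Ω} (hD : MeasurableSet D) {τ : ℝ}
    (hτ : μ.real Dᶜ ≤ τ * μ.real univ) (hτ2 : τ ≤ 1 / 2) {h : Ω → ℝ} {B : ℝ} (hm : AEStronglyMeasurable h μ) (hb : ∀ x, |h x| ≤ B) :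
    |(∫ x, h x ∂μ) / μ.real univ - (∫ x in D, h x ∂μ) / μ.real D| ≤ 2 * τ * B := by
  have hm0 := measureReal_univ_pos (μ := μ)
  have hsplit := measureReal_add_measureReal_compl (μ := μ) hD
  have hmD := half_le_real hD hτ hτ2
  have hmD0 : 0 < μ.real D := by linarith
  have hδ0 : 0 ≤ μ.real Dᶜ := measureReal_nonneg
  have hint : Integrable h μ := integrable_of_bounded hm hb
  -- a point exists, so `0 ≤ B`
  have hB : 0 ≤ B := by
    rcases isEmpty_or_nonempty Ω with hΩ | ⟨⟨x⟩⟩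
    · exfalso
      have : μ.real univ = 0 := by rw [Set.univ_eq_empty_iff.2 hΩ, measureReal_empty]
      linarith
    · exact (abs_nonneg _).trans (hb x)
  have hI : ∫ x, h x ∂μ = (∫ x in D, h x ∂μ) + ∫ x in Dᶜ, h x ∂μ := (integral_add_compl hD hint).symm
  have hID : |∫ x in D, h x ∂μ| ≤ B * μ.real D := by
    have h := norm_setIntegral_le_of_norm_le_const (measure_lt_top μ D) (fun x _ => show ‖h x‖ ≤ B by rw [Real.norm_eq_abs]; exact hb x)
    rwa [Real.norm_eq_abs] at h
  have hIc : |∫ x in Dᶜ, h x ∂μ| ≤ B * μ.real Dᶜ := by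
    have h := norm_setIntegral_le_of_norm_le_const (measure_lt_top μ Dᶜ) (fun x _ => show ‖h x‖ ≤ B by rw [Real.norm_eq_abs]; exact hb x)
    rwa [Real.norm_eq_abs] at h
  have key : (∫ x, h x ∂μ) / μ.real univ - (∫ x in D, h x ∂μ) / μ.real D =
      -((∫ x in D, h x ∂μ) * μ.real Dᶜ / (μ.real univ * μ.real D)) + (∫ x in Dᶜ, h x ∂μ) / μ.real univ := by
    rw [hI, ← hsplit]
    field_simp
    ring
  rw [key]
  calc |-((∫ x in D, h x ∂μ) * μ.real Dᶜ / (μ.real univ * μ.real D)) + (∫ x in Dᶜ, h x ∂μ) / μ.real univ|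
      ≤ |(∫ x in D, h x ∂μ) * μ.real Dᶜ / (μ.real univ * μ.real D)| + |(∫ x in Dᶜ, h x ∂μ) / μ.real univ| := by
        have := abs_add_le (-((∫ x in D, h x ∂μ) * μ.real Dᶜ / (μ.real univ * μ.real D))) ((∫ x in Dᶜ, h x ∂μ) / μ.real univ)
        rwa [abs_neg] at this
    _ = |∫ x in D, h x ∂μ| * μ.real Dᶜ / (μ.real univ * μ.real D) + |∫ x in Dᶜ, h x ∂μ| / μ.real univ := by
        rw [abs_div, abs_div, abs_mul, abs_of_nonneg hδ0, abs_of_pos hm0, abs_of_pos (mul_pos hm0 hmD0)]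
    _ ≤ (B * μ.real D) * μ.real Dᶜ / (μ.real univ * μ.real D) + (B * μ.real Dᶜ) / μ.real univ := by
        gcongr
    _ = 2 * B * (μ.real Dᶜ / μ.real univ) := by
        field_simp
        ring
    _ ≤ 2 * B * τ := by
        refine mul_le_mul_of_nonneg_left ?_ (by positivity)
        rwa [div_le_iff₀ hm0]
    _ = 2 * τ * B := by ring

/-- ★ **Covariances move by `≤ 6τB²` under restriction.**  `μ` finite, `μ ≠ 0`, `μ.real Dᶜ ≤ τ·μ.real univ`, `τ ≤ 1/2`, `|F|, |G| ≤ B`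
a.e.-strongly measurable: with `Cov_ν(F,G) := ∫FG dν/ν.real univ − (∫F dν/ν.real univ)(∫G dν/ν.real univ)` for `ν = μ` and `ν = μ.restrict D`
(whose total mass is `μ.real D`), `|Cov_μ(F,G) − Cov_{μ|D}(F,G)| ≤ 6τB²`. -/
theorem abs_cov_sub_cov_restrict_le [IsFiniteMeasure μ] [NeZero μ] {D : Set Ω} (hD : MeasurableSet D) {τ : ℝ}
    (hτ : μ.real Dᶜ ≤ τ * μ.real univ) (hτ2 : τ ≤ 1 / 2) {F G : Ω → ℝ} {B : ℝ} (hFm : AEStronglyMeasurable F μ) (hGm : AEStronglyMeasurable G μ)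
    (hFb : ∀ x, |F x| ≤ B) (hGb : ∀ x, |G x| ≤ B) :
    |((∫ x, F x * G x ∂μ) / μ.real univ - (∫ x, F x ∂μ) / μ.real univ * ((∫ x, G x ∂μ) / μ.real univ)) -
        ((∫ x in D, F x * G x ∂μ) / μ.real D - (∫ x in D, F x ∂μ) / μ.real D * ((∫ x in D, G x ∂μ) / μ.real D))| ≤ 6 * τ * B ^ 2 := by
  have hm0 := measureReal_univ_pos (μ := μ)
  have hmD := half_le_real hD hτ hτ2
  have hmD0 : 0 < μ.real D := by linarith
  have hB : 0 ≤ B := by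
    rcases isEmpty_or_nonempty Ω with hΩ | ⟨⟨x⟩⟩
    · exfalso
      have : μ.real univ = 0 := by rw [Set.univ_eq_empty_iff.2 hΩ, measureReal_empty]
      linarith
    · exact (abs_nonneg _).trans (hFb x)
  have hτ0 : 0 ≤ τ := by
    have : 0 ≤ μ.real Dᶜ := measureReal_nonneg
    nlinarith
  have hFGb : ∀ x, |F x * G x| ≤ B ^ 2 := fun x => by
    rw [abs_mul, sq]; exact mul_le_mul (hFb x) (hGb x) (abs_nonneg _) ((abs_nonneg _).trans (hFb x))
  -- the three average displacements
  have h1 := abs_avg_sub_avg_restrict_le hD hτ hτ2 (hFm.mul hGm) hFGb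
  have h2 := abs_avg_sub_avg_restrict_le hD hτ hτ2 hFm hFb
  have h3 := abs_avg_sub_avg_restrict_le hD hτ hτ2 hGm hGb
  -- sizes of the averages
  have havg : ∀ {h : Ω → ℝ}, (∀ x, |h x| ≤ B) → |(∫ x, h x ∂μ) / μ.real univ| ≤ B := by
    intro h hb
    rw [abs_div, abs_of_pos hm0, div_le_iff₀ hm0]
    have := norm_integral_le_of_norm_le_const (μ := μ) (Filter.Eventually.of_forall fun x => show ‖h x‖ ≤ B by rw [Real.norm_eq_abs]; exact hb x)
    rwa [Real.norm_eq_abs] at this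
  have havgD : ∀ {h : Ω → ℝ}, (∀ x, |h x| ≤ B) → |(∫ x in D, h x ∂μ) / μ.real D| ≤ B := by
    intro h hb
    rw [abs_div, abs_of_pos hmD0, div_le_iff₀ hmD0]
    have := norm_setIntegral_le_of_norm_le_const (measure_lt_top μ D) (fun x _ => show ‖h x‖ ≤ B by rw [Real.norm_eq_abs]; exact hb x)
    rwa [Real.norm_eq_abs] at this
  set aFG := (∫ x, F x * G x ∂μ) / μ.real univ
  set aF := (∫ x, F x ∂μ) / μ.real univ
  set aG := (∫ x, G x ∂μ) / μ.real univ
  set dFG := (∫ x in D, F x * G x ∂μ) / μ.real D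
  set dF := (∫ x in D, F x ∂μ) / μ.real D
  set dG := (∫ x in D, G x ∂μ) / μ.real D
  have hprod : |aF * aG - dF * dG| ≤ 4 * τ * B ^ 2 := by
    have e : aF * aG - dF * dG = (aF - dF) * aG + dF * (aG - dG) := by ring
    rw [e]
    calc |(aF - dF) * aG + dF * (aG - dG)| ≤ |aF - dF| * |aG| + |dF| * |aG - dG| := by
          have := abs_add_le ((aF - dF) * aG) (dF * (aG - dG)); rwa [abs_mul, abs_mul] at this
      _ ≤ (2 * τ * B) * B + B * (2 * τ * B) :=
          add_le_add (mul_le_mul h2 (havg hGb) (abs_nonneg _) (by positivity)) (mul_le_mul (havgD hFb) h3 (abs_nonneg _) hB)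
      _ = 4 * τ * B ^ 2 := by ring
  have e : (aFG - aF * aG) - (dFG - dF * dG) = (aFG - dFG) - (aF * aG - dF * dG) := by ring
  rw [e]
  calc |(aFG - dFG) - (aF * aG - dF * dG)| ≤ |aFG - dFG| + |aF * aG - dF * dG| := abs_sub _ _
    _ ≤ 2 * τ * B ^ 2 + 4 * τ * B ^ 2 := add_le_add h1 hprod
    _ = 6 * τ * B ^ 2 := by ring

end Restrict

/-! ## §2 The tilt letters at `t = 0` -/

namespace Tilt

variable {Ω : Type*} [MeasurableSpace Ω]

/-- `E_0[G] = ∫ G dμ / μ.real univ`. -/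
theorem tiltExp_zero (μ : Measure Ω) (U : Ω → ℝ) (G : Ω → ℝ) : tiltExp μ U 0 G = (∫ x, G x ∂μ) / μ.real univ := by
  simp only [tiltExp, zero_mul, Real.exp_zero, mul_one, integral_const, smul_eq_mul]

/-- `E_0` for the restricted measure: `∫_D G dμ / μ.real D`. -/
theorem tiltExp_zero_restrict (μ : Measure Ω) (D : Set Ω) (U : Ω → ℝ) (G : Ω → ℝ) :
    tiltExp (μ.restrict D) U 0 G = (∫ x in D, G x ∂μ) / μ.real D := by
  rw [tiltExp_zero, measureReal_restrict_apply_univ]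

/-- `Cov_0(F,G) = ∫FG/μ.real univ − (∫F/μ.real univ)(∫G/μ.real univ)`. -/
theorem tiltCov_zero (μ : Measure Ω) (U : Ω → ℝ) (F G : Ω → ℝ) :
    tiltCov μ U 0 F G = (∫ x, F x * G x ∂μ) / μ.real univ - (∫ x, F x ∂μ) / μ.real univ * ((∫ x, G x ∂μ) / μ.real univ) := by
  simp only [tiltCov, tiltExp_zero]

/-- `Cov_0` for the restricted measure. -/
theorem tiltCov_zero_restrict (μ : Measure Ω) (D : Set Ω) (U : Ω → ℝ) (F G : Ω → ℝ) :
    tiltCov (μ.restrict D) U 0 F G =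
      (∫ x in D, F x * G x ∂μ) / μ.real D - (∫ x in D, F x ∂μ) / μ.real D * ((∫ x in D, G x ∂μ) / μ.real D) := by
  simp only [tiltCov, tiltExp_zero_restrict]

/-- ★ **Restriction moves the `t = 0` covariance by `≤ 6τB²`** (✓`Restrict.abs_cov_sub_cov_restrict_le` in tilt letters; any `U`). -/
theorem abs_tiltCov_zero_sub_restrict_le {μ : Measure Ω} [IsFiniteMeasure μ] [NeZero μ] {D : Set Ω} (hD : MeasurableSet D) {τ : ℝ}
    (hτ : μ.real Dᶜ ≤ τ * μ.real univ) (hτ2 : τ ≤ 1 / 2) (U : Ω → ℝ) {F G : Ω → ℝ} {B : ℝ} (hFm : AEStronglyMeasurable F μ)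
    (hGm : AEStronglyMeasurable G μ) (hFb : ∀ x, |F x| ≤ B) (hGb : ∀ x, |G x| ≤ B) :
    |tiltCov μ U 0 F G - tiltCov (μ.restrict D) U 0 F G| ≤ 6 * τ * B ^ 2 := by
  rw [tiltCov_zero, tiltCov_zero_restrict]
  exact Restrict.abs_cov_sub_cov_restrict_le hD hτ hτ2 hFm hGm hFb hGb

end Tilt

/-! ## §3 The Gaussian / small-field instance -/

namespace GaussRestrict

open EdgeChartGaussian (integrable_gaussWeight integral_gaussWeight_pos gaussWeight_pos aestronglyMeasurable_gaussWeight)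

variable (H : ℕ) {β : ℝ}

/-- The density `ofReal ∘ gaussWeight` is a.e.-measurable. -/
theorem aemeasurable_ofReal_gaussWeight (hβ : 0 < β) :
    AEMeasurable (fun a : LandauFree H → E3 => ENNReal.ofReal (gaussWeight β H a)) volume :=
  ENNReal.measurable_ofReal.comp_aemeasurable (aestronglyMeasurable_gaussWeight H hβ).aemeasurable

/-- `μ_G := volume.withDensity (ofReal ∘ gaussWeight)` is a finite measure. -/
theorem isFiniteMeasure_withDensity (hβ : 0 < β) :
    IsFiniteMeasure ((volume : Measure (LandauFree H → E3)).withDensity fun a => ENNReal.ofReal (gaussWeight β H a)) :=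
  isFiniteMeasure_withDensity_ofReal (integrable_gaussWeight H hβ).hasFiniteIntegral

/-- Integration against `μ_G` is integration against the weight: `∫ F dμ_G = ∫ F·gaussWeight`. -/
theorem integral_withDensity_eq (hβ : 0 < β) (F : (LandauFree H → E3) → ℝ) :
    ∫ a, F a ∂((volume : Measure (LandauFree H → E3)).withDensity fun a => ENNReal.ofReal (gaussWeight β H a)) =
      ∫ a, F a * gaussWeight β H a := by
  rw [integral_withDensity_eq_integral_toReal_smul₀ (aemeasurable_ofReal_gaussWeight H hβ) (Filter.Eventually.of_forall fun _ => ENNReal.ofReal_lt_top)]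
  refine integral_congr_ae (Filter.Eventually.of_forall fun a => ?_)
  simp only [ENNReal.toReal_ofReal (gaussWeight_pos β H a).le, smul_eq_mul, mul_comm]

/-- Set version: `∫_s F dμ_G = ∫_s F·gaussWeight` for measurable `s`. -/
theorem setIntegral_withDensity_eq (hβ : 0 < β) {s : Set (LandauFree H → E3)} (hs : MeasurableSet s) (F : (LandauFree H → E3) → ℝ) :
    ∫ a in s, F a ∂((volume : Measure (LandauFree H → E3)).withDensity fun a => ENNReal.ofReal (gaussWeight β H a)) =
      ∫ a in s, F a * gaussWeight β H a := by
  rw [restrict_withDensity hs, integral_withDensity_eq_integral_toReal_smul₀ ((aemeasurable_ofReal_gaussWeight H hβ).restrict)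
    (Filter.Eventually.of_forall fun _ => ENNReal.ofReal_lt_top)]
  refine integral_congr_ae (Filter.Eventually.of_forall fun a => ?_)
  simp only [ENNReal.toReal_ofReal (gaussWeight_pos β H a).le, smul_eq_mul, mul_comm]

/-- The real mass of a measurable set: `μ_G.real s = ∫_s gaussWeight`. -/
theorem real_withDensity_eq (hβ : 0 < β) {s : Set (LandauFree H → E3)} (hs : MeasurableSet s) :
    ((volume : Measure (LandauFree H → E3)).withDensity fun a => ENNReal.ofReal (gaussWeight β H a)).real s = ∫ a in s, gaussWeight β H a := by
  rw [measureReal_def, withDensity_apply _ hs, ← ofReal_integral_eq_lintegral_ofReal (integrable_gaussWeight H hβ).integrableOn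
    (Filter.Eventually.of_forall fun a => (gaussWeight_pos β H a).le), ENNReal.toReal_ofReal (setIntegral_nonneg hs fun a _ => (gaussWeight_pos β H a).le)]

/-- The total real mass: `μ_G.real univ = ∫ gaussWeight > 0`. -/
theorem real_withDensity_univ (hβ : 0 < β) :
    ((volume : Measure (LandauFree H → E3)).withDensity fun a => ENNReal.ofReal (gaussWeight β H a)).real univ = ∫ a, gaussWeight β H a := by
  rw [real_withDensity_eq H hβ MeasurableSet.univ, Measure.restrict_univ]

/-- `μ_G ≠ 0`. -/
theorem neZero_withDensity (hβ : 0 < β) :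
    NeZero ((volume : Measure (LandauFree H → E3)).withDensity fun a => ENNReal.ofReal (gaussWeight β H a)) := by
  refine ⟨fun h0 => ?_⟩
  have h := real_withDensity_univ H hβ
  rw [h0] at h
  simp only [measureReal_def, Measure.coe_zero, Pi.zero_apply, ENNReal.toReal_zero] at h
  linarith [integral_gaussWeight_pos H hβ]

/-- ★ **`gaussAvg` is the `t = 0` tilted expectation of `μ_G`** (any `U`): `gaussAvg β H F = Tilt.tiltExp μ_G U 0 F`. -/
theorem gaussAvg_eq_tiltExp_zero (hβ : 0 < β) (U F : (LandauFree H → E3) → ℝ) :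
    gaussAvg β H F = Tilt.tiltExp ((volume : Measure (LandauFree H → E3)).withDensity fun a => ENNReal.ofReal (gaussWeight β H a)) U 0 F := by
  rw [Tilt.tiltExp_zero, integral_withDensity_eq H hβ, real_withDensity_univ H hβ, gaussAvg]

/-- `gaussCov β H F G = Tilt.tiltCov μ_G U 0 F G`. -/
theorem gaussCov_eq_tiltCov_zero (hβ : 0 < β) (U F G : (LandauFree H → E3) → ℝ) :
    gaussCov β H F G = Tilt.tiltCov ((volume : Measure (LandauFree H → E3)).withDensity fun a => ENNReal.ofReal (gaussWeight β H a)) U 0 F G := by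
  simp only [gaussCov, Tilt.tiltCov, gaussAvg_eq_tiltExp_zero H hβ U]

/-- The co-mass of the small-field box: `μ_G.real (smallField H s)ᶜ = E₀[1 − 1_{smallField s}] · μ_G.real univ` (✓`GaussTail.gaussAvg_one_sub_sfInd_eq`). -/
theorem real_compl_smallField_eq (hβ : 0 < β) (s : ℝ) :
    ((volume : Measure (LandauFree H → E3)).withDensity fun a => ENNReal.ofReal (gaussWeight β H a)).real (smallField H s)ᶜ =
      gaussAvg β H (fun a => 1 - sfInd H s a) *
        ((volume : Measure (LandauFree H → E3)).withDensity fun a => ENNReal.ofReal (gaussWeight β H a)).real univ := by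
  rw [real_withDensity_eq H hβ (ChartGauss.measurableSet_smallField s).compl, real_withDensity_univ H hβ, GaussTail.gaussAvg_one_sub_sfInd_eq]
  change _ = (∫ a in (smallField H s)ᶜ, gaussWeight β H a) / (∫ a, gaussWeight β H a) * ∫ a, gaussWeight β H a
  rw [div_mul_cancel₀ _ (integral_gaussWeight_pos H hβ).ne']

/-- The restricted Gaussian measure is the assembler's `μ_D`: `μ_G.restrict D = (volume.restrict D).withDensity (ofReal ∘ gaussWeight)`. -/
theorem restrict_smallField_eq (β : ℝ) (s : ℝ) :
    ((volume : Measure (LandauFree H → E3)).withDensity fun a => ENNReal.ofReal (gaussWeight β H a)).restrict (smallField H s) =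
      ((volume : Measure (LandauFree H → E3)).restrict (smallField H s)).withDensity fun a => ENNReal.ofReal (gaussWeight β H a) :=
  restrict_withDensity (ChartGauss.measurableSet_smallField s) _

/-- The small-field box is the closed sup-norm ball of radius `s` (for `s ≥ 0`). -/
theorem smallField_eq_closedBall {s : ℝ} (hs : 0 ≤ s) : smallField H s = Metric.closedBall (0 : LandauFree H → E3) s := by
  ext a
  simp only [smallField, Set.mem_setOf_eq, Metric.mem_closedBall, dist_zero_right, pi_norm_le_iff_of_nonneg hs]

/-- The small-field box of positive radius has positive volume. -/
theorem volume_smallField_pos {s : ℝ} (hs : 0 < s) : 0 < volume (smallField H s) := by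
  rw [smallField_eq_closedBall H hs.le]
  exact Metric.measure_closedBall_pos volume _ hs

/-- `μ_G.restrict (smallField H s) ≠ 0` for `s > 0`. -/
theorem neZero_restrict_smallField (hβ : 0 < β) {s : ℝ} (hs : 0 < s) :
    NeZero (((volume : Measure (LandauFree H → E3)).withDensity fun a => ENNReal.ofReal (gaussWeight β H a)).restrict (smallField H s)) := by
  refine ⟨fun h0 => ?_⟩
  have h1 : (((volume : Measure (LandauFree H → E3)).withDensity fun a => ENNReal.ofReal (gaussWeight β H a)).restrict (smallField H s))
      (smallField H s) = 0 := by rw [h0]; rfl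
  rw [Measure.restrict_apply_self, withDensity_apply _ (ChartGauss.measurableSet_smallField s)] at h1
  rw [lintegral_eq_zero_iff' ((aemeasurable_ofReal_gaussWeight H hβ).restrict)] at h1
  have h2 : (volume.restrict (smallField H s)) {a | (fun a => ENNReal.ofReal (gaussWeight β H a)) a ≠ (0 : (LandauFree H → E3) → ENNReal) a} = 0 :=
    ae_iff.1 h1
  have h3 : {a : LandauFree H → E3 | (fun a => ENNReal.ofReal (gaussWeight β H a)) a ≠ (0 : (LandauFree H → E3) → ENNReal) a} = Set.univ := by
    ext a
    simp only [Set.mem_setOf_eq, Pi.zero_apply, ne_eq, ENNReal.ofReal_eq_zero, not_le, Set.mem_univ, iff_true]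
    exact gaussWeight_pos β H a
  rw [h3, Measure.restrict_apply_univ] at h2
  exact (volume_smallField_pos H hs).ne' h2

/-- ★★ **T-S5.13r, Gaussian instance.**  If `E₀[1 − 1_{smallField H s}] ≤ τ ≤ 1/2` (e.g. from ✓6g `gaussianSmallFieldTail`) then for measurable `F`, `G` with
`|F|, |G| ≤ B`: `|gaussCov β H F G − Tilt.tiltCov (μ_G.restrict (smallField H s)) U 0 F G| ≤ 6τB²` (any `U`; `μ_G = volume.withDensity (ofReal ∘ gaussWeight β H)`). -/
theorem abs_gaussCov_sub_tiltCov_restrict_le (hβ : 0 < β) (s : ℝ) {τ : ℝ} (hτ : gaussAvg β H (fun a => 1 - sfInd H s a) ≤ τ) (hτ2 : τ ≤ 1 / 2)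
    (U : (LandauFree H → E3) → ℝ) {F G : (LandauFree H → E3) → ℝ} {B : ℝ} (hFm : Measurable F) (hGm : Measurable G)
    (hFb : ∀ a, |F a| ≤ B) (hGb : ∀ a, |G a| ≤ B) :
    |gaussCov β H F G - Tilt.tiltCov ((((volume : Measure (LandauFree H → E3)).withDensity fun a => ENNReal.ofReal (gaussWeight β H a))).restrict
        (smallField H s)) U 0 F G| ≤ 6 * τ * B ^ 2 := by
  haveI := isFiniteMeasure_withDensity H hβ
  haveI := neZero_withDensity H hβ
  rw [gaussCov_eq_tiltCov_zero H hβ U]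
  refine Tilt.abs_tiltCov_zero_sub_restrict_le (ChartGauss.measurableSet_smallField s) ?_ hτ2 U hFm.aestronglyMeasurable hGm.aestronglyMeasurable hFb hGb
  rw [real_compl_smallField_eq H hβ s]
  exact mul_le_mul_of_nonneg_right hτ measureReal_nonneg

end GaussRestrict

end Summit.QuantumFields.YangMills.Theorems.AllWindowsColdBoxBoxHighLine

end
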